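import Summits.ResolutionOfSingularities.ResolutionOfSingularities.Theorems.FrobeniusLadderFInjectiveMacaulayficationHWeightedData
import Mathlib.RingTheory.MvPolynomial.WeightedHomogeneous
import Mathlib.Algebra.MvPolynomial.PDeriv
import Mathlib.Algebra.MvPolynomial.Equiv
import Mathlib.Algebra.Polynomial.Degree.Domain
import Mathlib.RingTheory.Polynomial.UniqueFactorization
import Mathlib.RingTheory.Ideal.Quotient.Operations
import HarnessLib

/-!
# RGDD-L row F008 at `p = 5` — the first RELATIVE weighted-GDD instance: characteristic-free data of the diagonal form
# `g = z² + t⁴w⁶ + (y² + x³)³ + x¹¹ + w⁷ + t·x³y·w³` and of its `(2,3,9,3 | 0)`-initial form `g₀` along the `t`-axis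
# (crux `FInjectiveMacaulayfication` stmt-ResolutionOfSingularities-15315, relative filtered engine `FilteredConeFiModelRel`;
# RULING R15.39 (2) + ERRATUM 18:55:29Z + R15.44 (2) + R15.45 of res-L1-w45a-plan-1)

Support file for crux stmt-ResolutionOfSingularities-15315 (`FrobeniusLadder.FInjectiveMacaulayfication`), chain w45a, seat
res-L1-w45a-stub-1 g6. [OURS · L1 W4.5a; specimen = RGDD-L row F008 (res-L1-w45a-idea-2, `RGDDL-r1.md`; (P)-certificate by machine,
hpow decided by res-L1-w45a-tri-1 TRIAGE v30 §45 and typed by res-L1-w45a-stub-4 as `RelGddF008Hpow`); templates `GxzData` / `GxzVeronese` (res-L1-w45a-stub-4), `G1TailData`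
(res-L1-w45a-stub-3)] — NOT a statement of the manuscript [claim: Hironaka2017]; AI-written, weaker than expert review.

**The row.** `F008 = T₁₁ + t·x³y·w³ + t²·z·w³`, `T₁₁ = z² + (y² + x³)³ + x¹¹ + w⁷`, in `k[x,y,z,w,t] = k[X₀,…,X₄]`, `char k = 5`:
an integral fourfold hypersurface singular EXACTLY along the `t`-axis `L = V(x,y,z,w)` (so its bad locus is a CURVE, not a point),
to be F-injectively Macaulayfied by ONE weighted blow-up RELATIVE to `L`: weights `w = (2,3,9,3 | t ↦ 0)`, `N = D = 18`,
`c = (9,6,2,6)`, centre `I₁₈ = (monomials of w-weight ≥ 18) ⊂ (x,y,z,w)`.  As for `G_xz` (`…GxzGradedFiModel`), we first apply the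
GRADED coordinate change `σ : z ↦ z + 2t²w³` (`z` and `t²w³` both weigh `9`; `σ` preserves `I₁₈`): in characteristic `5`,
`σ(F008) = g + 5·(t²w³z + t⁴w⁶)`, so `k[X]/(F008) ≅ k[X]/(g)` with the DIAGONAL form (no term linear in `z`)

  `g = X₂² + X₄⁴X₃⁶ + (X₁² + X₀³)³ + X₄X₀³X₁X₃³ + X₀¹¹ + X₃⁷`, initial form `g₀ = X₂² + X₄⁴X₃⁶ + (X₁² + X₀³)³ + X₄X₀³X₁X₃³`

(`w`-weight `18`; the tail `X₀¹¹ + X₃⁷` has weights `22, 21`).  This file supplies the characteristic-free inputs of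
`FilteredConeFiModelRel.filteredConeFiModelRel_affineBlowup` for `(g, g₀)`:

* `g0_isWeightedHomogeneous` (weight `18`), `weightedHomogeneousComponent_eighteen` (`= g₀`), `weightedHomogeneousComponent_lt_eighteen`
  (`= 0`), `g0_ne_zero`, `g_ne_zero`;
* `prime_g` — `g` is prime over EVERY field and divides no variable (`k[X] ≃ k[Y₀,…,Y₃][T]`, `X₂ ↦ T`, `g ↦ T² + c`, `c(0,0,T,0) = T⁷`
  of odd degree), `span_g_isPrime`, `g_X_ne_zero`;
* the five partial derivatives of `g` and of `g₀` (integer coefficients, any commutative ring);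
* (the Veronese saturation `hpow` for `w = (2,3,9,3,0)`, `N = 18` is NOT here: it is res-L1-w45a-stub-4's
  `RelGddF008Hpow.hpow_2393_18`, landed separately);
* `exists_sigma`, `sigma_f008_eq` — the graded automorphism and `σ(F008) = g` in characteristic `5`.

All proofs are glue on Mathlib and landed files; no definitions, no named facts. [folklore]
-/

-- single-problem summit: the doubled namespace component is forced
set_option linter.dupNamespace false

noncomputable section

namespace Summit.ResolutionOfSingularities.ResolutionOfSingularities.Theorems.FInjectiveMacaulayfication.RelGddF008Data

open MvPolynomial
open Summit.ResolutionOfSingularities.ResolutionOfSingularities.Theorems.FInjectiveMacaulayfication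

/-! ## Weighted homogeneity and the initial form -/

/-- `g₀ = X₂² + X₄⁴X₃⁶ + (X₁² + X₀³)³ + X₄X₀³X₁X₃³` is `(2,3,9,3,0)`-weighted-homogeneous of weight `18`. [folklore] -/
theorem g0_isWeightedHomogeneous (k : Type) [Field k] :
    MvPolynomial.IsWeightedHomogeneous (![2, 3, 9, 3, 0] : Fin 5 → ℕ)
      (X 2 ^ 2 + X 4 ^ 4 * X 3 ^ 6 + (X 1 ^ 2 + X 0 ^ 3) ^ 3 + X 4 * X 0 ^ 3 * X 1 * X 3 ^ 3 : MvPolynomial (Fin 5) k) 18 := by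
  have hX := fun j : Fin 5 => isWeightedHomogeneous_X k (![2, 3, 9, 3, 0] : Fin 5 → ℕ) j
  have hφ : IsWeightedHomogeneous (![2, 3, 9, 3, 0] : Fin 5 → ℕ) (X 1 ^ 2 + X 0 ^ 3 : MvPolynomial (Fin 5) k) 6 := by
    refine IsWeightedHomogeneous.add ?_ ?_
    · simpa using (hX 1).pow 2
    · simpa using (hX 0).pow 3
  refine (((?_ : IsWeightedHomogeneous _ _ 18).add ?_).add ?_).add ?_
  · simpa using (hX 2).pow 2
  · simpa using ((hX 4).pow 4).mul ((hX 3).pow 6)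
  · simpa using hφ.pow 3
  · simpa using (((hX 4).mul ((hX 0).pow 3)).mul (hX 1)).mul ((hX 3).pow 3)

/-- The tail term `X₀¹¹` has `(2,3,9,3,0)`-weight `22`. [folklore] -/
theorem x11_isWeightedHomogeneous (k : Type) [Field k] :
    MvPolynomial.IsWeightedHomogeneous (![2, 3, 9, 3, 0] : Fin 5 → ℕ) (X 0 ^ 11 : MvPolynomial (Fin 5) k) 22 := by
  simpa using (isWeightedHomogeneous_X k (![2, 3, 9, 3, 0] : Fin 5 → ℕ) 0).pow 11

/-- The tail term `X₃⁷` has `(2,3,9,3,0)`-weight `21`. [folklore] -/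
theorem w7_isWeightedHomogeneous (k : Type) [Field k] :
    MvPolynomial.IsWeightedHomogeneous (![2, 3, 9, 3, 0] : Fin 5 → ℕ) (X 3 ^ 7 : MvPolynomial (Fin 5) k) 21 := by
  simpa using (isWeightedHomogeneous_X k (![2, 3, 9, 3, 0] : Fin 5 → ℕ) 3).pow 7

/-- **The `(2,3,9,3,0)`-weight-`18` component of `g` is `g₀`.** [folklore] -/
theorem weightedHomogeneousComponent_eighteen (k : Type) [Field k] (g : MvPolynomial (Fin 5) k)
    (hg : g = X 2 ^ 2 + X 4 ^ 4 * X 3 ^ 6 + (X 1 ^ 2 + X 0 ^ 3) ^ 3 + X 4 * X 0 ^ 3 * X 1 * X 3 ^ 3 + X 0 ^ 11 + X 3 ^ 7) :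
    MvPolynomial.weightedHomogeneousComponent (![2, 3, 9, 3, 0] : Fin 5 → ℕ) 18 g =
      X 2 ^ 2 + X 4 ^ 4 * X 3 ^ 6 + (X 1 ^ 2 + X 0 ^ 3) ^ 3 + X 4 * X 0 ^ 3 * X 1 * X 3 ^ 3 := by
  rw [hg, map_add, map_add, (g0_isWeightedHomogeneous k).weightedHomogeneousComponent_same,
    (x11_isWeightedHomogeneous k).weightedHomogeneousComponent_ne 18 (by norm_num),
    (w7_isWeightedHomogeneous k).weightedHomogeneousComponent_ne 18 (by norm_num), add_zero, add_zero]

/-- **`g` has `(2,3,9,3,0)`-order `18`**: all weighted-homogeneous components below `18` vanish. [folklore] -/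
theorem weightedHomogeneousComponent_lt_eighteen (k : Type) [Field k] (g : MvPolynomial (Fin 5) k)
    (hg : g = X 2 ^ 2 + X 4 ^ 4 * X 3 ^ 6 + (X 1 ^ 2 + X 0 ^ 3) ^ 3 + X 4 * X 0 ^ 3 * X 1 * X 3 ^ 3 + X 0 ^ 11 + X 3 ^ 7) :
    ∀ m < 18, MvPolynomial.weightedHomogeneousComponent (![2, 3, 9, 3, 0] : Fin 5 → ℕ) m g = 0 := by
  intro m hm
  rw [hg, map_add, map_add, (g0_isWeightedHomogeneous k).weightedHomogeneousComponent_ne m (by omega),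
    (x11_isWeightedHomogeneous k).weightedHomogeneousComponent_ne m (by omega),
    (w7_isWeightedHomogeneous k).weightedHomogeneousComponent_ne m (by omega), add_zero, add_zero]

/-- `g₀ ≠ 0` (it takes the value `1` at `(0,0,1,0,0)`). [folklore] -/
theorem g0_ne_zero (k : Type) [Field k] :
    (X 2 ^ 2 + X 4 ^ 4 * X 3 ^ 6 + (X 1 ^ 2 + X 0 ^ 3) ^ 3 + X 4 * X 0 ^ 3 * X 1 * X 3 ^ 3 : MvPolynomial (Fin 5) k) ≠ 0 := by
  intro h0
  have h1 := congrArg (MvPolynomial.eval ![(0 : k), 0, 1, 0, 0]) h0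
  simp at h1

/-- `g ≠ 0` (it takes the value `1` at `(0,0,1,0,0)`). [folklore] -/
theorem g_ne_zero (k : Type) [Field k] :
    (X 2 ^ 2 + X 4 ^ 4 * X 3 ^ 6 + (X 1 ^ 2 + X 0 ^ 3) ^ 3 + X 4 * X 0 ^ 3 * X 1 * X 3 ^ 3 + X 0 ^ 11 + X 3 ^ 7 :
      MvPolynomial (Fin 5) k) ≠ 0 := by
  intro h0
  have h1 := congrArg (MvPolynomial.eval ![(0 : k), 0, 1, 0, 0]) h0
  simp at h1

/-! ## Primality over every field -/

/-- **`g` is prime over every field and divides no variable** (`k[X₀,…,X₄] ≃ k[Y₀,…,Y₃][T]`, `X₂ ↦ T`, `X₀ ↦ C Y₁`, `X₁ ↦ C Y₀`,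
`X₃ ↦ C Y₂`, `X₄ ↦ C Y₃`; `g ↦ T² + c`, `c(0,0,T,0) = T⁷` has odd degree). [folklore] -/
theorem prime_g (k : Type) [Field k] (g : MvPolynomial (Fin 5) k)
    (hg : g = X 2 ^ 2 + X 4 ^ 4 * X 3 ^ 6 + (X 1 ^ 2 + X 0 ^ 3) ^ 3 + X 4 * X 0 ^ 3 * X 1 * X 3 ^ 3 + X 0 ^ 11 + X 3 ^ 7) :
    Prime g ∧ ∀ v : Fin 5, ¬ g ∣ MvPolynomial.X v := by
  obtain ⟨e, he0, he1, he2, he3, he4⟩ : ∃ e : MvPolynomial (Fin 5) k ≃+* Polynomial (MvPolynomial (Fin 4) k),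
      e (X 0) = Polynomial.C (X 1) ∧ e (X 1) = Polynomial.C (X 0) ∧ e (X 2) = Polynomial.X ∧
        e (X 3) = Polynomial.C (X 2) ∧ e (X 4) = Polynomial.C (X 3) := by
    refine ⟨((renameEquiv k (Equiv.swap (0 : Fin 5) 2)).trans (finSuccEquiv k 4)).toRingEquiv, ?_, ?_, ?_, ?_, ?_⟩
    · show finSuccEquiv k 4 (rename (Equiv.swap (0 : Fin 5) 2) (X 0)) = _
      rw [rename_X, Equiv.swap_apply_left]
      exact finSuccEquiv_X_succ (j := 1)
    · show finSuccEquiv k 4 (rename (Equiv.swap (0 : Fin 5) 2) (X 1)) = _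
      rw [rename_X, Equiv.swap_apply_of_ne_of_ne (by decide) (by decide)]
      exact finSuccEquiv_X_succ (j := 0)
    · show finSuccEquiv k 4 (rename (Equiv.swap (0 : Fin 5) 2) (X 2)) = _
      rw [rename_X, Equiv.swap_apply_right]
      exact finSuccEquiv_X_zero
    · show finSuccEquiv k 4 (rename (Equiv.swap (0 : Fin 5) 2) (X 3)) = _
      rw [rename_X, Equiv.swap_apply_of_ne_of_ne (by decide) (by decide)]
      exact finSuccEquiv_X_succ (j := 2)
    · show finSuccEquiv k 4 (rename (Equiv.swap (0 : Fin 5) 2) (X 4)) = _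
      rw [rename_X, Equiv.swap_apply_of_ne_of_ne (by decide) (by decide)]
      exact finSuccEquiv_X_succ (j := 3)
  have heg : e g = Polynomial.X ^ 2 +
      Polynomial.C (X 3 ^ 4 * X 2 ^ 6 + (X 0 ^ 2 + X 1 ^ 3) ^ 3 + X 3 * X 1 ^ 3 * X 0 * X 2 ^ 3 + X 1 ^ 11 + X 2 ^ 7 :
        MvPolynomial (Fin 4) k) := by
    subst hg
    simp only [map_add, map_mul, map_pow, he0, he1, he2, he3, he4]
    ring
  have hc : ∀ a : MvPolynomial (Fin 4) k,
      a * a ≠ -(X 3 ^ 4 * X 2 ^ 6 + (X 0 ^ 2 + X 1 ^ 3) ^ 3 + X 3 * X 1 ^ 3 * X 0 * X 2 ^ 3 + X 1 ^ 11 + X 2 ^ 7) := by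
    refine HWeightedData.mul_self_ne_neg_of_odd_natDegree ![0, 0, Polynomial.X, 0] ?_
    have hv : MvPolynomial.aeval (![0, 0, Polynomial.X, 0] : Fin 4 → Polynomial k)
        (X 3 ^ 4 * X 2 ^ 6 + (X 0 ^ 2 + X 1 ^ 3) ^ 3 + X 3 * X 1 ^ 3 * X 0 * X 2 ^ 3 + X 1 ^ 11 + X 2 ^ 7 :
          MvPolynomial (Fin 4) k) = Polynomial.X ^ 7 := by
      simp only [map_add, map_mul, map_pow, MvPolynomial.aeval_X, Matrix.cons_val_zero, Matrix.cons_val_one, Matrix.cons_val]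
      norm_num
    rw [hv, Polynomial.natDegree_X_pow]
    decide
  obtain ⟨hp, hnd⟩ := E8Forms.prime_and_not_dvd_of_ringEquiv e g _ heg hc
  refine ⟨hp, fun v => ?_⟩
  fin_cases v
  · exact hnd (X 0) (X 1) (X_ne_zero 1) he0
  · exact hnd (X 1) (X 0) (X_ne_zero 0) he1
  · rintro ⟨q, hq⟩
    have h1 : (Polynomial.X ^ 2 + Polynomial.C (X 3 ^ 4 * X 2 ^ 6 + (X 0 ^ 2 + X 1 ^ 3) ^ 3 + X 3 * X 1 ^ 3 * X 0 * X 2 ^ 3 +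
        X 1 ^ 11 + X 2 ^ 7) : Polynomial (MvPolynomial (Fin 4) k)) ∣ Polynomial.X :=
      ⟨e q, by rw [← heg, ← map_mul, ← hq]; exact he2.symm⟩
    have h2 := Polynomial.natDegree_le_of_dvd h1 Polynomial.X_ne_zero
    rw [Polynomial.natDegree_X_pow_add_C, Polynomial.natDegree_X] at h2
    omega
  · exact hnd (X 3) (X 2) (X_ne_zero 2) he3
  · exact hnd (X 4) (X 3) (X_ne_zero 3) he4

/-- `(g)` is a prime ideal. [folklore] -/
theorem span_g_isPrime (k : Type) [Field k] (g : MvPolynomial (Fin 5) k)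
    (hg : g = X 2 ^ 2 + X 4 ^ 4 * X 3 ^ 6 + (X 1 ^ 2 + X 0 ^ 3) ^ 3 + X 4 * X 0 ^ 3 * X 1 * X 3 ^ 3 + X 0 ^ 11 + X 3 ^ 7) :
    (Ideal.span {g}).IsPrime :=
  (Ideal.span_singleton_prime (prime_g k g hg).1.ne_zero).mpr (prime_g k g hg).1

/-- No variable lies in `(g)`. [folklore] -/
theorem g_X_ne_zero (k : Type) [Field k] (g : MvPolynomial (Fin 5) k)
    (hg : g = X 2 ^ 2 + X 4 ^ 4 * X 3 ^ 6 + (X 1 ^ 2 + X 0 ^ 3) ^ 3 + X 4 * X 0 ^ 3 * X 1 * X 3 ^ 3 + X 0 ^ 11 + X 3 ^ 7)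
    (v : Fin 5) : Ideal.Quotient.mk (Ideal.span {g}) (MvPolynomial.X v) ≠ 0 := fun h0 =>
  (prime_g k g hg).2 v (Ideal.mem_span_singleton.mp (Ideal.Quotient.eq_zero_iff_mem.mp h0))

/-! ## Partial derivatives of `g` and of `g₀` -/

/-- `∂₀ g = 9X₀²(X₁² + X₀³)² + 3X₄X₀²X₁X₃³ + 11X₀¹⁰`. [folklore] -/
theorem pderiv_zero_g {A : Type*} [CommRing A] :
    pderiv 0 (X 2 ^ 2 + X 4 ^ 4 * X 3 ^ 6 + (X 1 ^ 2 + X 0 ^ 3) ^ 3 + X 4 * X 0 ^ 3 * X 1 * X 3 ^ 3 + X 0 ^ 11 + X 3 ^ 7 :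
      MvPolynomial (Fin 5) A) =
      9 * X 0 ^ 2 * (X 1 ^ 2 + X 0 ^ 3) ^ 2 + 3 * X 4 * X 0 ^ 2 * X 1 * X 3 ^ 3 + 11 * X 0 ^ 10 := by
  simp only [map_add, Derivation.leibniz, pderiv_pow, pderiv_X_self, smul_eq_mul,
    pderiv_X_of_ne (show (1 : Fin 5) ≠ 0 by decide), pderiv_X_of_ne (show (2 : Fin 5) ≠ 0 by decide),
    pderiv_X_of_ne (show (3 : Fin 5) ≠ 0 by decide), pderiv_X_of_ne (show (4 : Fin 5) ≠ 0 by decide)]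
  norm_num
  ring

/-- `∂₁ g = 6X₁(X₁² + X₀³)² + X₄X₀³X₃³`. [folklore] -/
theorem pderiv_one_g {A : Type*} [CommRing A] :
    pderiv 1 (X 2 ^ 2 + X 4 ^ 4 * X 3 ^ 6 + (X 1 ^ 2 + X 0 ^ 3) ^ 3 + X 4 * X 0 ^ 3 * X 1 * X 3 ^ 3 + X 0 ^ 11 + X 3 ^ 7 :
      MvPolynomial (Fin 5) A) =
      6 * X 1 * (X 1 ^ 2 + X 0 ^ 3) ^ 2 + X 4 * X 0 ^ 3 * X 3 ^ 3 := by
  simp only [map_add, Derivation.leibniz, pderiv_pow, pderiv_X_self, smul_eq_mul,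
    pderiv_X_of_ne (show (0 : Fin 5) ≠ 1 by decide), pderiv_X_of_ne (show (2 : Fin 5) ≠ 1 by decide),
    pderiv_X_of_ne (show (3 : Fin 5) ≠ 1 by decide), pderiv_X_of_ne (show (4 : Fin 5) ≠ 1 by decide)]
  norm_num
  ring

/-- `∂₂ g = 2X₂`. [folklore] -/
theorem pderiv_two_g {A : Type*} [CommRing A] :
    pderiv 2 (X 2 ^ 2 + X 4 ^ 4 * X 3 ^ 6 + (X 1 ^ 2 + X 0 ^ 3) ^ 3 + X 4 * X 0 ^ 3 * X 1 * X 3 ^ 3 + X 0 ^ 11 + X 3 ^ 7 :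
      MvPolynomial (Fin 5) A) = 2 * X 2 := by
  simp only [map_add, Derivation.leibniz, pderiv_pow, pderiv_X_self, smul_eq_mul,
    pderiv_X_of_ne (show (0 : Fin 5) ≠ 2 by decide), pderiv_X_of_ne (show (1 : Fin 5) ≠ 2 by decide),
    pderiv_X_of_ne (show (3 : Fin 5) ≠ 2 by decide), pderiv_X_of_ne (show (4 : Fin 5) ≠ 2 by decide)]
  norm_num

/-- `∂₃ g = 6X₄⁴X₃⁵ + 3X₄X₀³X₁X₃² + 7X₃⁶`. [folklore] -/
theorem pderiv_three_g {A : Type*} [CommRing A] :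
    pderiv 3 (X 2 ^ 2 + X 4 ^ 4 * X 3 ^ 6 + (X 1 ^ 2 + X 0 ^ 3) ^ 3 + X 4 * X 0 ^ 3 * X 1 * X 3 ^ 3 + X 0 ^ 11 + X 3 ^ 7 :
      MvPolynomial (Fin 5) A) = 6 * X 4 ^ 4 * X 3 ^ 5 + 3 * X 4 * X 0 ^ 3 * X 1 * X 3 ^ 2 + 7 * X 3 ^ 6 := by
  simp only [map_add, Derivation.leibniz, pderiv_pow, pderiv_X_self, smul_eq_mul,
    pderiv_X_of_ne (show (0 : Fin 5) ≠ 3 by decide), pderiv_X_of_ne (show (1 : Fin 5) ≠ 3 by decide),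
    pderiv_X_of_ne (show (2 : Fin 5) ≠ 3 by decide), pderiv_X_of_ne (show (4 : Fin 5) ≠ 3 by decide)]
  norm_num
  ring

/-- `∂₄ g = 4X₄³X₃⁶ + X₀³X₁X₃³`. [folklore] -/
theorem pderiv_four_g {A : Type*} [CommRing A] :
    pderiv 4 (X 2 ^ 2 + X 4 ^ 4 * X 3 ^ 6 + (X 1 ^ 2 + X 0 ^ 3) ^ 3 + X 4 * X 0 ^ 3 * X 1 * X 3 ^ 3 + X 0 ^ 11 + X 3 ^ 7 :
      MvPolynomial (Fin 5) A) = 4 * X 4 ^ 3 * X 3 ^ 6 + X 0 ^ 3 * X 1 * X 3 ^ 3 := by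
  simp only [map_add, Derivation.leibniz, pderiv_pow, pderiv_X_self, smul_eq_mul,
    pderiv_X_of_ne (show (0 : Fin 5) ≠ 4 by decide), pderiv_X_of_ne (show (1 : Fin 5) ≠ 4 by decide),
    pderiv_X_of_ne (show (2 : Fin 5) ≠ 4 by decide), pderiv_X_of_ne (show (3 : Fin 5) ≠ 4 by decide)]
  norm_num
  ring

/-- `∂₀ g₀ = 9X₀²(X₁² + X₀³)² + 3X₄X₀²X₁X₃³`. [folklore] -/
theorem pderiv_zero_g0 {A : Type*} [CommRing A] :
    pderiv 0 (X 2 ^ 2 + X 4 ^ 4 * X 3 ^ 6 + (X 1 ^ 2 + X 0 ^ 3) ^ 3 + X 4 * X 0 ^ 3 * X 1 * X 3 ^ 3 : MvPolynomial (Fin 5) A) =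
      9 * X 0 ^ 2 * (X 1 ^ 2 + X 0 ^ 3) ^ 2 + 3 * X 4 * X 0 ^ 2 * X 1 * X 3 ^ 3 := by
  simp only [map_add, Derivation.leibniz, pderiv_pow, pderiv_X_self, smul_eq_mul,
    pderiv_X_of_ne (show (1 : Fin 5) ≠ 0 by decide), pderiv_X_of_ne (show (2 : Fin 5) ≠ 0 by decide),
    pderiv_X_of_ne (show (3 : Fin 5) ≠ 0 by decide), pderiv_X_of_ne (show (4 : Fin 5) ≠ 0 by decide)]
  norm_num
  ring

/-- `∂₁ g₀ = 6X₁(X₁² + X₀³)² + X₄X₀³X₃³`. [folklore] -/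
theorem pderiv_one_g0 {A : Type*} [CommRing A] :
    pderiv 1 (X 2 ^ 2 + X 4 ^ 4 * X 3 ^ 6 + (X 1 ^ 2 + X 0 ^ 3) ^ 3 + X 4 * X 0 ^ 3 * X 1 * X 3 ^ 3 : MvPolynomial (Fin 5) A) =
      6 * X 1 * (X 1 ^ 2 + X 0 ^ 3) ^ 2 + X 4 * X 0 ^ 3 * X 3 ^ 3 := by
  simp only [map_add, Derivation.leibniz, pderiv_pow, pderiv_X_self, smul_eq_mul,
    pderiv_X_of_ne (show (0 : Fin 5) ≠ 1 by decide), pderiv_X_of_ne (show (2 : Fin 5) ≠ 1 by decide),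
    pderiv_X_of_ne (show (3 : Fin 5) ≠ 1 by decide), pderiv_X_of_ne (show (4 : Fin 5) ≠ 1 by decide)]
  norm_num
  ring

/-- `∂₂ g₀ = 2X₂`. [folklore] -/
theorem pderiv_two_g0 {A : Type*} [CommRing A] :
    pderiv 2 (X 2 ^ 2 + X 4 ^ 4 * X 3 ^ 6 + (X 1 ^ 2 + X 0 ^ 3) ^ 3 + X 4 * X 0 ^ 3 * X 1 * X 3 ^ 3 : MvPolynomial (Fin 5) A) =
      2 * X 2 := by
  simp only [map_add, Derivation.leibniz, pderiv_pow, pderiv_X_self, smul_eq_mul,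
    pderiv_X_of_ne (show (0 : Fin 5) ≠ 2 by decide), pderiv_X_of_ne (show (1 : Fin 5) ≠ 2 by decide),
    pderiv_X_of_ne (show (3 : Fin 5) ≠ 2 by decide), pderiv_X_of_ne (show (4 : Fin 5) ≠ 2 by decide)]
  norm_num

/-- `∂₃ g₀ = 6X₄⁴X₃⁵ + 3X₄X₀³X₁X₃²`. [folklore] -/
theorem pderiv_three_g0 {A : Type*} [CommRing A] :
    pderiv 3 (X 2 ^ 2 + X 4 ^ 4 * X 3 ^ 6 + (X 1 ^ 2 + X 0 ^ 3) ^ 3 + X 4 * X 0 ^ 3 * X 1 * X 3 ^ 3 : MvPolynomial (Fin 5) A) =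
      6 * X 4 ^ 4 * X 3 ^ 5 + 3 * X 4 * X 0 ^ 3 * X 1 * X 3 ^ 2 := by
  simp only [map_add, Derivation.leibniz, pderiv_pow, pderiv_X_self, smul_eq_mul,
    pderiv_X_of_ne (show (0 : Fin 5) ≠ 3 by decide), pderiv_X_of_ne (show (1 : Fin 5) ≠ 3 by decide),
    pderiv_X_of_ne (show (2 : Fin 5) ≠ 3 by decide), pderiv_X_of_ne (show (4 : Fin 5) ≠ 3 by decide)]
  norm_num
  ring

/-- `∂₄ g₀ = 4X₄³X₃⁶ + X₀³X₁X₃³`. [folklore] -/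
theorem pderiv_four_g0 {A : Type*} [CommRing A] :
    pderiv 4 (X 2 ^ 2 + X 4 ^ 4 * X 3 ^ 6 + (X 1 ^ 2 + X 0 ^ 3) ^ 3 + X 4 * X 0 ^ 3 * X 1 * X 3 ^ 3 : MvPolynomial (Fin 5) A) =
      4 * X 4 ^ 3 * X 3 ^ 6 + X 0 ^ 3 * X 1 * X 3 ^ 3 := by
  simp only [map_add, Derivation.leibniz, pderiv_pow, pderiv_X_self, smul_eq_mul,
    pderiv_X_of_ne (show (0 : Fin 5) ≠ 4 by decide), pderiv_X_of_ne (show (1 : Fin 5) ≠ 4 by decide),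
    pderiv_X_of_ne (show (2 : Fin 5) ≠ 4 by decide), pderiv_X_of_ne (show (3 : Fin 5) ≠ 4 by decide)]
  norm_num
  ring

/-! ## The graded coordinate change `σ : z ↦ z + 2t²w³` -/

/-- **The graded coordinate change `σ : X₂ ↦ X₂ + 2X₄²X₃³`** as a `k`-algebra automorphism of `k[X₀,…,X₄]` (inverse
`X₂ ↦ X₂ − 2X₄²X₃³`; `X₂` and `X₄²X₃³` both have `(2,3,9,3,0)`-weight `9`). [folklore] -/
theorem exists_sigma (k : Type) [Field k] :
    ∃ σ : MvPolynomial (Fin 5) k ≃ₐ[k] MvPolynomial (Fin 5) k,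
      σ (X 0) = X 0 ∧ σ (X 1) = X 1 ∧ σ (X 2) = X 2 + 2 * X 4 ^ 2 * X 3 ^ 3 ∧ σ (X 3) = X 3 ∧ σ (X 4) = X 4 := by
  let v : Fin 5 → MvPolynomial (Fin 5) k := ![X 0, X 1, X 2 + 2 * X 4 ^ 2 * X 3 ^ 3, X 3, X 4]
  let v' : Fin 5 → MvPolynomial (Fin 5) k := ![X 0, X 1, X 2 - 2 * X 4 ^ 2 * X 3 ^ 3, X 3, X 4]
  have h1 : (aeval v).comp (aeval v') = AlgHom.id k (MvPolynomial (Fin 5) k) := by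
    refine MvPolynomial.algHom_ext fun i => ?_
    fin_cases i <;> simp [v, v', map_ofNat]
  have h2 : (aeval v').comp (aeval v) = AlgHom.id k (MvPolynomial (Fin 5) k) := by
    refine MvPolynomial.algHom_ext fun i => ?_
    fin_cases i <;> simp [v, v', map_ofNat]
  refine ⟨AlgEquiv.ofAlgHom (aeval v) (aeval v') h1 h2, ?_, ?_, ?_, ?_, ?_⟩ <;> simp [v]

/-- In characteristic `5`, `σ(F008) = g`: `(z + 2t²w³)² + t²w³(z + 2t²w³) − z² − t⁴w⁶ = 5·(t²w³z + t⁴w⁶)`. [folklore] -/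
theorem sigma_f008_eq (k : Type) [Field k] [CharP k 5] (σ : MvPolynomial (Fin 5) k ≃ₐ[k] MvPolynomial (Fin 5) k)
    (h0 : σ (X 0) = X 0) (h1 : σ (X 1) = X 1) (h2 : σ (X 2) = X 2 + 2 * X 4 ^ 2 * X 3 ^ 3) (h3 : σ (X 3) = X 3)
    (h4 : σ (X 4) = X 4) :
    σ (X 2 ^ 2 + (X 1 ^ 2 + X 0 ^ 3) ^ 3 + X 0 ^ 11 + X 3 ^ 7 + X 4 * X 0 ^ 3 * X 1 * X 3 ^ 3 + X 4 ^ 2 * X 2 * X 3 ^ 3) =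
      X 2 ^ 2 + X 4 ^ 4 * X 3 ^ 6 + (X 1 ^ 2 + X 0 ^ 3) ^ 3 + X 4 * X 0 ^ 3 * X 1 * X 3 ^ 3 + X 0 ^ 11 + X 3 ^ 7 := by
  have h5 : (5 : MvPolynomial (Fin 5) k) = 0 := by exact_mod_cast CharP.cast_eq_zero (MvPolynomial (Fin 5) k) 5
  simp only [map_add, map_mul, map_pow, h0, h1, h2, h3, h4]
  linear_combination (X 4 ^ 2 * X 3 ^ 3 * X 2 + X 4 ^ 4 * X 3 ^ 6) * h5

end Summit.ResolutionOfSingularities.ResolutionOfSingularities.Theorems.FInjectiveMacaulayfication.RelGddF008Data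

end
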